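import Literature.NumberTheory.NumberFields.HasseUnitIndexCriteria
import Literature.NumberTheory.NumberFields.CMFieldCapitulationKernel
import Literature.NumberTheory.NumberFields.NarrowClassGroup
import Literature.Geometry.Kaehler.ComplexTorusRealMultiplicationNarrowClassNumber
import HarnessLib

/-!
# Odd narrow class number of `K⁺` forces `Q_K = 1` and `κ_K = 1` (Okazaki 2000, Lemma 15; Hasse's Satz 25 in
# Lemmermeyer's printed form)

Topic `NumberTheory/NumberFields`; namespace `Literature.NumberTheory.NumberFields`.  Theorem-only file (no
definition, no named fact, no `sorry`).  `Q_K` = Hasse's unit index of the CM field `K` (Mathlib `indexRealUnits`),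
`κ_K = #ker(ι : Cl_{K⁺} → Cl_K)`, `h⁺(F)` = the narrow class number (`narrowClassNumber`, tree
`NarrowClassGroup.lean`), `U⁺/U²` = totally positive units of `𝓞_F` modulo squares of units (tree
`ComplexTorus.TotPosUnitsModSq`, with `h⁺ = h · #U⁺/U²` for totally real `F`,
`ComplexTorus.narrowClassNumber_eq_classNumber_mul_card_totPosUnitsModSq`).

> Okazaki, §3 **Lemma 15.** "Let `M` be a totally real number field and `r` the `2`-rank of `C_M⁺` [the strict
> class group].  Then the number of non-primary CM-extensions `F/M` is `2^r`.  Hence, the number of CM-extensions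
> `F/M` such that `κ_F Q_F = 2` is either `2^r − 1` or `2^r`.  **Moreover, there is no CM-extension `F/M` such that
> `κ_F Q_F = 2` if `r = 0`.**"  (proof: "Assume `r = 0` and let `F` be an arbitrary CM-extension of `M`.  Then
> `κ_F = 1` … The fact `Q_F = 1` is well known (cf. [16]).")
> Lemmermeyer 1995 (= [16]), §2 Prop. 1 **c) (Satz 25)** "If `L⁺` contains units with any given signature, then
> `Q(L) = 1`.  … our assumption implies that totally positive units are squares".

`r = 0` is `h⁺(M)` odd.  Chain: `h⁺(K⁺)` odd ⟹ `#U⁺/U² = h⁺/h` is odd, and it is a power of `2`, so it is `1`: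
**every totally positive unit of `K⁺` is the square of a unit** (equivalently, units of every signature exist);
⟹ `Q_K = 1` by Satz 25 (`Lemmermeyer1995.indexRealUnits_eq_one_of_forall_isSquare`); and `h(K⁺) ∣ h⁺(K⁺)` is
odd while `κ_K ∣ 2`, so `κ_K = 1`.

## Main results (`F` totally real; `K` CM)

* `forall_isSquare_of_totallyPositive_of_odd_narrowClassNumber` — `h⁺(F)` odd ⟹ totally positive units of `F`
  are squares of units.
* **`IsCMField.indexRealUnits_eq_one_of_odd_narrowClassNumber`** — `h⁺(K⁺)` odd ⟹ `Q_K = 1`.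
* **`IsCMField.card_ker_classGroupExtend_eq_one_of_odd_narrowClassNumber`**,
  `IsCMField.classGroupExtend_injective_of_odd_narrowClassNumber` — `h⁺(K⁺)` odd ⟹ `κ_K = 1`.
* **`IsCMField.card_ker_mul_indexRealUnits_eq_one_of_odd_narrowClassNumber`** — Lemma 15's last clause:
  `h⁺(K⁺)` odd ⟹ `κ_K · Q_K = 1`.

Honest column: the counts `2^r` / `2^r − 1` of Lemma 15 (strict-class-group bookkeeping of non-primary
extensions) are NOT typed; only the `r = 0` clause.  Related material in another vocabulary:
`Automorphic/Arthur2013/Leaves/TorusSignatures.lean` (`indexRealUnits_eq_one_of_signatures`, dictionary variables).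

## References

* R. Okazaki, *Inclusion of CM-fields and divisibility of relative class numbers*, Acta Arith. 92 (2000) 319–338,
  §3 Lemma 15 and its proof (held `paper:doi-10-4064-aa-92-4-319-338`, p. 8). [Okazaki2000]
* F. Lemmermeyer, *Ideal class groups of cyclotomic number fields I*, Acta Arith. 72 (1995), §2 Prop. 1 c)
  (held `paper:arxiv-1202.5777`, p. 4). [Lemmermeyer1995]
* A. Fröhlich, M. J. Taylor, *Algebraic Number Theory*, Ch. V §1 (1.12). [FrohlichTaylor1990]
* H. Lange, *Abelian Varieties over the Complex Numbers* (2023), §2.4.5 Ex. (15)–(16). [Lange2023AbelianVarietiesComplex]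
-/

noncomputable section

open NumberField NumberField.IsCMField NumberField.Units Module
open Literature.Geometry.Kaehler Literature.Geometry.Kaehler.ComplexTorus

namespace Literature.NumberTheory.NumberFields

/-! ### §1. `h⁺(F)` odd ⟹ totally positive units of `F` are squares -/

section TotallyReal

variable (F : Type*) [Field F] [NumberField F] [IsTotallyReal F]

/-- **`h⁺(F)` odd ⟹ `#U⁺/U² = 1`** for a totally real `F` (`h⁺ = h · #U⁺/U²`, and `#U⁺/U²` is a power of `2`).
[cite: FrohlichTaylor1990, Ch. V §1 (1.12)] [cite: Lange2023AbelianVarietiesComplex, §2.4.5 Ex. (15)–(16)] -/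
theorem card_totPosUnitsModSq_eq_one_of_odd_narrowClassNumber (hodd : Odd (narrowClassNumber F)) :
    Nat.card (TotPosUnitsModSq F) = 1 := by
  obtain ⟨k, -, hk⟩ := exists_card_totPosUnitsModSq_eq_two_pow (K := F)
  rw [narrowClassNumber_eq_classNumber_mul_card_totPosUnitsModSq, hk] at hodd
  have h2 : Odd (2 ^ k) := (Nat.odd_mul.mp hodd).2
  rcases Nat.eq_zero_or_pos k with h0 | hpos
  · rw [hk, h0, pow_zero]
  · exact absurd h2 (Nat.not_odd_iff_even.mpr ((Nat.even_pow' hpos.ne').mpr even_two))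

/-- **`h⁺(F)` odd ⟹ every totally positive unit of the totally real field `F` is the square of a unit**
(«units with any given signature» ⟺ «totally positive units are squares»; here from `#U⁺/U² = h⁺/h = 1`).
[cite: Lemmermeyer1995, §2 Proposition 1 c) (proof)] [cite: Okazaki2000, §3 Lemma 15 (proof, case r = 0)] -/
theorem forall_isSquare_of_totallyPositive_of_odd_narrowClassNumber (hodd : Odd (narrowClassNumber F))
    (u : (𝓞 F)ˣ) (hu : ∀ σ : F →+* ℝ, 0 < σ ((u : 𝓞 F) : F)) : IsSquare u := by
  have h1 := card_totPosUnitsModSq_eq_one_of_odd_narrowClassNumber F hodd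
  haveI : Subsingleton (TotPosUnitsModSq F) := (Nat.card_eq_one_iff_unique.mp h1).1
  have heq : (Quot.mk _ ⟨u, hu⟩ : TotPosUnitsModSq F) = Quot.mk _ ⟨1, fun σ => by simp⟩ :=
    Subsingleton.elim _ _
  obtain ⟨ε, hε⟩ := (totPosUnitsModSq_mk_eq_mk_iff F _ _).mp heq
  refine ⟨ε, ?_⟩
  have hε' : u = ε ^ 2 * 1 := hε
  rw [hε', mul_one, pow_two]

end TotallyReal

/-! ### §2. `h⁺(K⁺)` odd ⟹ `Q_K = 1`, `κ_K = 1` (Okazaki's Lemma 15, `r = 0`) -/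

section CM

variable (K : Type) [Field K] [NumberField K] [IsCMField K]

/-- **`h⁺(K⁺)` odd ⟹ `Q_K = 1`** (Hasse's Satz 25 as printed by Lemmermeyer, via «totally positive units are
squares»; Okazaki: «The fact `Q_F = 1` is well known (cf. [16])»). [cite: Okazaki2000, §3 Lemma 15]
[cite: Lemmermeyer1995, §2 Proposition 1 c)] -/
theorem IsCMField.indexRealUnits_eq_one_of_odd_narrowClassNumber
    (hodd : Odd (narrowClassNumber (maximalRealSubfield K))) : indexRealUnits K = 1 :=
  Lemmermeyer1995.indexRealUnits_eq_one_of_forall_isSquare K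
    (forall_isSquare_of_totallyPositive_of_odd_narrowClassNumber (maximalRealSubfield K) hodd)

/-- **`h⁺(K⁺)` odd ⟹ `κ_K = 1`**: `κ_K ∣ 2` (Washington 10.3) and `κ_K ∣ h(K⁺) ∣ h⁺(K⁺)`.
[cite: Okazaki2000, §3 Lemma 15 (proof: «Then κ_F = 1 follows …»)] [cite: Washington1997, Thm. 10.3] -/
theorem IsCMField.card_ker_classGroupExtend_eq_one_of_odd_narrowClassNumber
    (hodd : Odd (narrowClassNumber (maximalRealSubfield K))) :
    Nat.card (classGroupExtend (maximalRealSubfield K) K).ker = 1 := by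
  have h2 : Nat.card (classGroupExtend (maximalRealSubfield K) K).ker ∣ 2 := by
    rcases card_ker_classGroupExtend_eq_one_or_two K with h | h
    · rw [h]; exact one_dvd 2
    · rw [h]
  have hh : Nat.card (classGroupExtend (maximalRealSubfield K) K).ker ∣ narrowClassNumber (maximalRealSubfield K) := by
    refine dvd_trans ?_ (classNumber_dvd_narrowClassNumber (maximalRealSubfield K))
    rw [classNumber, ← Nat.card_eq_fintype_card]
    exact Subgroup.card_subgroup_dvd_card _
  exact Nat.Coprime.eq_one_of_dvd (Nat.Coprime.coprime_dvd_left h2 hodd.coprime_two_left) hh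

/-- `h⁺(K⁺)` odd ⟹ `ι : Cl_{K⁺} → Cl_K` is injective. [cite: Okazaki2000, §3 Lemma 15] -/
theorem IsCMField.classGroupExtend_injective_of_odd_narrowClassNumber
    (hodd : Odd (narrowClassNumber (maximalRealSubfield K))) :
    Function.Injective (classGroupExtend (maximalRealSubfield K) K) := by
  rw [← MonoidHom.ker_eq_bot_iff]
  exact Subgroup.eq_bot_of_card_eq _ (IsCMField.card_ker_classGroupExtend_eq_one_of_odd_narrowClassNumber K hodd)

/-- **Okazaki's Lemma 15, last clause: if the strict class group of `K⁺` has odd order then `κ_K · Q_K = 1`**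
(«there is no CM-extension `F/M` such that `κ_F Q_F = 2` if `r = 0`»; `κ_F Q_F ∣ 2` always).
[cite: Okazaki2000, §3 Lemma 15] -/
theorem IsCMField.card_ker_mul_indexRealUnits_eq_one_of_odd_narrowClassNumber
    (hodd : Odd (narrowClassNumber (maximalRealSubfield K))) :
    Nat.card (classGroupExtend (maximalRealSubfield K) K).ker * indexRealUnits K = 1 := by
  rw [IsCMField.card_ker_classGroupExtend_eq_one_of_odd_narrowClassNumber K hodd,
    IsCMField.indexRealUnits_eq_one_of_odd_narrowClassNumber K hodd]

end CM

end Literature.NumberTheory.NumberFields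

end
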